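import Literature.Probability.LatticeModels.HighDimTrivialityMoments

/-!
# High-dimensional triviality of Ising scaling limits, III: Wick's law and Aizenman's inequality

Trunk: StatMech (G02); family `crit-ising` (crit-ising.S13). Namespace `Literature.CritIsing`.
Third layer under `HighDimTriviality` / `HighDimTrivialityMoments`: the random-current input of
the Gaussianity of scaling limits is moved from the level of the moments of the smeared field
(`aizenman_evenMoment_deviation_le`, `newman_evenMoment_le` of `HighDimTrivialityMoments`) to
the level of correlation functions, where it is a printed statement:

* M. Aizenman, H. Duminil-Copin, *Marginal triviality of the scaling limits of critical 4D Ising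
  and `φ⁴₄` models*, Ann. of Math. 194 (2021) = arXiv:1912.07973 ("ADC"), §6.3, p. 26, first
  display (eq. (6.44), p. 42 of the held arXiv text; "the inequality, valid for every `n ≥ 2` and
  derived using the switching lemma in [Aiz82]"):
  `0 ≤ 𝒢_n[S_β](x₁,…,x_{2n}) - S_β(x₁,…,x_{2n})
     ≤ -(3/2) ∑_{1≤i<j<k<l≤2n} S_β(x₁,…,x̸_i,…,x̸_j,…,x̸_k,…,x̸_l,…,x_{2n}) U₄^β(x_i,x_j,x_k,x_l)`,
  with `𝒢_n[S₂](x₁,…,x_{2n}) = ∑_{pairings π} ∏_j S₂(x_{π(2j-1)}, x_{π(2j)})` (ADC §1.1, p. 3)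
  — **the upper inequality of this display misquotes [Aiz82, Prop. 12.1] and is false as printed
  (see §Correction below)**;
* R. Panis, arXiv:2309.05797, Prop. 4.6 "Deviation from Wick's law" (`d ≥ 2`, `n ≥ 2`; the
  inequality with `|U₄^β|` and the **pairing sum** `𝒢_{n-2}` of the remaining points — the
  source form, vendored in `AizenmanWickBound`).

## Contents

* Part I (combinatorics of Wick's law). `pairIdx`, `pairingSum S₂ n x` (`𝒢_n[S₂]`, written as
  the average over the `(2n)!` orderings, each pairing arising from `2ⁿ n!` of them);
  `sum_prod_mul_pairingSum`: `∑_{x ∈ Λ^{2n}} ∏ g(xᵢ) 𝒢_n[S₂](x) = (2n)!/(2ⁿn!) (∑ g g S₂)ⁿ`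
  (the smeared pairing sum is the Gaussian `2n`-th moment); `4`-subsets of the indices
  (`restrictFour`, `removeFour`, `splitEquiv`) and the factorisation
  `sum_prod_mul_removeFour_mul_restrictFour` of the smeared removed-points term.
* Part J (named facts, D-0014). `aizenman_nPoint_le_pairingSum` (lower inequality; discharged
  in the tree, `aizenman_nPoint_le_pairingSum_holds` of `HighDimTrivialityWickProofs`) and
  `aizenman_pairingSum_sub_nPoint_le` (upper inequality as quoted — **refuted and retired
  2026-08-15**, see §Correction below) for the states `μ ∈ 𝒢(β,0)`, `0 ≤ β ≤ β_c`, `d ≥ 2`.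
* Part K (**proved**). `newman_evenMoment_le_of_pointwise` and
  `aizenman_evenMoment_deviation_le_of_pointwise`: the two moment-level facts of
  `HighDimTrivialityMoments` follow by multiplying by `∏ᵢ f(xᵢ/L)` and summing
  (`integral_normalizedField_pow_sub_wick`; for signed `f` the absolute values are moved inside
  using `𝒢_n - S_{2n} ≥ 0`, which is why the bound involves the moments of `T_{|f|,L}`;
  `C(2n,4) ≤ (2n)⁴`).
* Part L. The capstone `…_printRegime_of_pointwise`: crit-ising.S13 (printed regime) from
  Aizenman's inequality, the two `∑ |U₄|` bounds (ADC Thm 1.3/§6.3 for `d = 4`, Panis §5 for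
  `d ≥ 5`) and the structural facts on `𝒢(β,0)` (uniqueness, free state, flip symmetry)
  (**vacuous since 2026-08-15** — its input `aizenman_pairingSum_sub_nPoint_le` is refuted; the
  live capstone is `…_printRegime_of_wickDeviation` of `HighDimTrivialityProofs`, §Correction).
* Part M (finite volume → infinite volume). The same two inequalities **in finite volume**
  (free boundary condition, zero field; named facts `aizenman_nPoint_le_pairingSum_finite` —
  discharged in the tree, `aizenman_nPoint_le_pairingSum_finite_holds` of `GaussianPairingBound` —
  and `aizenman_pairingSum_sub_nPoint_le_finite` — **refuted and retired 2026-08-15**, see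
  §Correction below) pass to every state whose correlations are the free box limits
  (`pairingLowerBound_of_finite`, `pairingUpperBound_of_finite`, via the tree's
  `hasBoxLimit_isingCorr_free_holds`), hence (**proved**) to the states `μ ∈ 𝒢(β,0)`, `β ≤ β_c`,
  `d ≥ 3`, given uniqueness and the free state (`pairingBounds_of_finite_of_facts`).
* Part N. The capstone from finite volume, `…_printRegime_of_finite`: crit-ising.S13 (printed
  regime) from eight named facts, of which the flip symmetry `isingCorr_free_of_odd_card` is
  discharged in the tree (`isingCorr_free_of_odd_card_holds` of `PlusFreeComparison`, not
  imported here); the deep inputs are the finite-volume Aizenman inequality (random currents),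
  the two `∑ |U₄|` bounds (ADC Thm 1.3/§6.3; Panis §5), uniqueness below and at `β_c`, and the
  free state (**vacuous since 2026-08-15** — its input `aizenman_pairingSum_sub_nPoint_le_finite`
  is refuted; the live capstone is `…_printRegime_of_wickDeviation` of `HighDimTrivialityProofs`,
  whose only undischarged inputs are `aizenman_wickDeviation_le_finite` — since proved —,
  `aizenmanDuminilCopin_ursellFourSum_le` and `panis_ursellFourSum_le`; §Correction).

## Correction (verdict clean-up, 2026-08-15): the upper inequality as quoted is false; the source form lives in `AizenmanWickBound`

The display quoted above is eq. (6.44) of the held arXiv text of Aizenman–Duminil-Copin 2021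
(§6.3 "Proof of Proposition 1.4", p. 42; journal p. 26), "derived using the switching lemma in
[1, Proposition 12.1]". Its source — M. Aizenman, Comm. Math. Phys. **86** (1982), Prop. 12.1,
eq. (12.3), restated verbatim in M. Aizenman, CDM 2020 = arXiv:2112.04248, Prop. 7.2,
eq. (7.1) (p. 23, "whereG_{2n} is the Wick functional") and in R. Panis, arXiv:2309.05797,
Prop. 4.6 (p. 20, "the pairing sum of the remaining points") — carries on the right-hand side
the **Wick functional** `G_{2n-4}[S₂] = 𝒢_{n-2}[S₂]` of the remaining `2n-4` points, not their
correlation function `S_{2n-4}`: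
`|S_{2n}(x) - 𝒢_n[S₂](x)| ≤ (3/2) ∑_{1≤j<k<l<m≤2n} |U₄(x_j,x_k,x_l,x_m)| 𝒢_{n-2}[S₂](…,x̸_j,…,x̸_k,…,x̸_l,…,x̸_m,…)`.
The `S_{2n-4}` form fails at coincident points for **every** probability measure on `{±1}^{ℤ^d}`
(`n = 5`, ten coincident points: `𝒢_5 = 945`, `S_{10} = S_6 = 1`, `U₄(0,0,0,0) = -2`, so it
would read `944 ≤ 630`): theorems `not_pairingUpperBound_at_zero`, `not_pairingUpperBound`,
`not_aizenman_pairingSum_sub_nPoint_le_finite` of `AizenmanWickBoundLocal` and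
`not_aizenman_pairingSum_sub_nPoint_le` of `AizenmanWickBoundRefutations`. Accordingly:

* the two named facts `aizenman_pairingSum_sub_nPoint_le` (Part J) and
  `aizenman_pairingSum_sub_nPoint_le_finite` (Part M) are **refuted as stated and retired from
  the literature debt**: no `…_holds` can exist; they are kept, `@[deprecated]`, only because
  their refutations (and the vacuous theorems listed below) name them;
* the corrected statement is **not** re-declared here (it would duplicate): it is the tree's
  `aizenman_wickDeviation_le_finite` (`AizenmanWickBound`, Part 1: Aizenman 1982, Prop. 12.1 on
  every finite graph, free boundary condition, zero field, `β ≥ 0`, with Aizenman's remainder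
  `wickRemainder`), a **theorem** of the tree (`aizenman_wickDeviation_le_finite_holds`,
  `AizenmanWickBoundProofs`), together with the state property `WickDeviationBound μ` and its
  passage to the limit `wickDeviationBound_of_finite` (`AizenmanWickBound`, Part 3);
* the predicate `PairingUpperBound μ` (Part J) keeps its body: it is the hypothesis shape of
  those refutations and holds for no probability measure (`not_pairingUpperBound`);
* every theorem of this file taking one of the two retired facts or `PairingUpperBound μ` as a
  hypothesis is **vacuous** and superseded by its source-form counterpart:
  `pairingUpperBound_of_finite` ↦ `wickDeviationBound_of_finite`,
  `pairingBounds_of_finite_of_facts` ↦ `pairingLowerBound_and_wickDeviationBound_of_freeCorr`,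
  `abs_integral_normalizedField_pow_sub_le_of_pairingBounds` ↦ `…_of_wickBounds`,
  `abs_mgf_normalizedField_sub_exp_le_of_pairingBounds` ↦ `…_of_wickBounds`,
  `aizenmanDuminilCopin_mgf_normalizedField_bound_abs_of_finite` ↦ `…_abs_of_wickDeviation`
  (all in `AizenmanWickBound`), `panis_mgf_normalizedField_bound_of_finite` ↦
  `…_of_wickDeviation` and `isGaussianProcess_…_printRegime_of_pointwise` / `…_of_finite` ↦
  `isGaussianProcess_…_printRegime_of_wickDeviation` (`HighDimTrivialityProofs`), while
  `aizenman_evenMoment_deviation_le_of_pointwise` derives the moment-level fact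
  `aizenman_evenMoment_deviation_le` of `HighDimTrivialityMoments`, itself refuted
  (`not_aizenman_evenMoment_deviation_le` of `AizenmanWickBoundRefutations`; corrected smeared
  form in `EvenMomentWickDeviation`). These seven theorems are kept with unchanged statements and
  are themselves `@[deprecated]` (each pointing at its replacement), because importers
  (`Literature/Barriers/CriticalPhenomena/IsingTrivialityFromDimensionFour{Proofs,HighDim}`) and
  the docstrings of the refutation files name them. The lower half (Newman's Gaussian inequality:
  `PairingLowerBound`, `aizenman_nPoint_le_pairingSum(_finite)`, both discharged in the tree),
  Part I, the lower-half results of Part K and the limits of Part M are unaffected.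

## Mathlib

Used: `Fintype.piFinset`, `Finset.sum_equiv` with `Equiv.arrowCongr` /
`Equiv.sumArrowEquivProdArrow` / `finTwoArrowEquiv` (reindexing lattice sums), `Finset.sum_pow'`,
`Fintype.card_perm`, `Fintype.card_finset_len`, `Nat.choose_le_pow`, `Finset.orderIsoOfFin` /
`Finset.orderEmbOfFin` (increasing enumeration of a subset of indices), `Equiv.sumCompl`.
Mathlib has no Wick pairings / hafnians; `pairingSum` is this file's.
-/

noncomputable section

open MeasureTheory Finset
open scoped Nat

namespace Literature.Probability.LatticeModels

/-- Indexing of `2n` points by pairs: `(j, k) ↦ 2j + k` (`j < n`, `k ∈ {0, 1}`), an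
equivalence `Fin n × Fin 2 ≃ Fin (2n)`; in the `1`-based indexing of the sources the `j`-th
pair is `(x_{2j-1}, x_{2j})`. [folklore] -/
def pairIdx (n : ℕ) : Fin n × Fin 2 ≃ Fin (2 * n) :=
  finProdFinEquiv.trans (finCongr (Nat.mul_comm n 2))

/-- `pairIdx n (j, k) = 2j + k`. [folklore] -/
theorem pairIdx_apply_val (n : ℕ) (j : Fin n) (k : Fin 2) :
    ((pairIdx n (j, k) : Fin (2 * n)) : ℕ) = 2 * j + k := by
  simp [pairIdx, Nat.mul_comm, Nat.add_comm]

/-- **The Gaussian pairing functional** `𝒢_n[S₂](x₁,…,x_{2n}) = ∑_π ∏_{j=1}^n S₂(x_{π(2j-1)}, x_{π(2j)})`,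
`π` ranging over the pairings of `{1,…,2n}` (Wick's law: the `2n`-point function of a centred
Gaussian field with covariance `S₂`). Written as the average over all `(2n)!` orderings
`τ` of `∏_j S₂(x_{τ(2j-1)}, x_{τ(2j)})`, divided by the `2ⁿ n!` orderings inducing each pairing
(for a symmetric `S₂` every ordering of a pairing contributes the same product). [cite: AizenmanDuminilCopinAnnals2021, arXiv:1912.07973 §1.1, display defining 𝒢_n (p. 3)] -/
def pairingSum {α : Type*} (S₂ : α → α → ℝ) (n : ℕ) (x : Fin (2 * n) → α) : ℝ :=
  ((2 : ℝ) ^ n * n !)⁻¹ *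
    ∑ τ : Equiv.Perm (Fin (2 * n)), ∏ j : Fin n, S₂ (x (τ (pairIdx n (j, 0)))) (x (τ (pairIdx n (j, 1))))

/-- `𝒢_n[S₂]` is a symmetric function of the `2n` points: relabelling the points by a
permutation `ρ` does not change it (reindex the average over orderings by `τ ↦ ρτ`). [folklore] -/
theorem pairingSum_comp_perm {α : Type*} (S₂ : α → α → ℝ) (n : ℕ) (x : Fin (2 * n) → α)
    (ρ : Equiv.Perm (Fin (2 * n))) : pairingSum S₂ n (x ∘ ρ) = pairingSum S₂ n x := by
  unfold pairingSum
  congr 1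
  exact Fintype.sum_equiv (Equiv.mulLeft ρ) _ _ fun τ => rfl

/-- Sums over `Λ^m` are invariant under relabelling the coordinates. [folklore] -/
theorem sum_piFinset_comp_perm {α : Type*} {m : ℕ} (Λ : Finset α) (τ : Equiv.Perm (Fin m))
    (Φ : (Fin m → α) → ℝ) :
    ∑ p ∈ Fintype.piFinset (fun _ : Fin m => Λ), Φ (p ∘ τ) =
      ∑ p ∈ Fintype.piFinset (fun _ : Fin m => Λ), Φ p := by
  refine Finset.sum_equiv (Equiv.arrowCongr τ.symm (Equiv.refl α)) (fun p => ?_) (fun p _ => ?_)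
  · simp only [Fintype.mem_piFinset, Equiv.arrowCongr_apply, Equiv.symm_symm, Equiv.coe_refl,
      Function.comp_apply, id_eq]
    exact ⟨fun h i => h _, fun h i => by simpa using h (τ.symm i)⟩
  · rfl

/-- **Fubini along a splitting of the coordinates.** For an identification
`e : Fin k ⊕ Fin l ≃ Fin m` of the index set with a disjoint union,
`∑_{p ∈ Λ^m} Φ(p ∘ e ∘ inl) Ψ(p ∘ e ∘ inr) = (∑_{q ∈ Λ^k} Φ q)(∑_{u ∈ Λ^l} Ψ u)`. [folklore] -/
theorem sum_piFinset_split {α : Type*} {k l m : ℕ} (Λ : Finset α) (e : Fin k ⊕ Fin l ≃ Fin m)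
    (Φ : (Fin k → α) → ℝ) (Ψ : (Fin l → α) → ℝ) :
    ∑ p ∈ Fintype.piFinset (fun _ : Fin m => Λ),
        Φ (fun j => p (e (Sum.inl j))) * Ψ (fun j => p (e (Sum.inr j))) =
      (∑ q ∈ Fintype.piFinset (fun _ : Fin k => Λ), Φ q) *
        ∑ u ∈ Fintype.piFinset (fun _ : Fin l => Λ), Ψ u := by
  rw [Finset.sum_mul_sum, ← Finset.sum_product']
  refine Finset.sum_equiv ((Equiv.arrowCongr e.symm (Equiv.refl α)).trans
    (Equiv.sumArrowEquivProdArrow _ _ α)) (fun p => ?_) (fun p _ => ?_)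
  · simp only [Fintype.mem_piFinset, Finset.mem_product, Equiv.trans_apply]
    constructor
    · intro h
      exact ⟨fun j => by simpa using h (e (Sum.inl j)), fun j => by simpa using h (e (Sum.inr j))⟩
    · rintro ⟨h₁, h₂⟩ i
      obtain ⟨y, rfl⟩ := e.surjective i
      rcases y with j | j
      · simpa using h₁ j
      · simpa using h₂ j
  · rfl

/-- Regrouping `Λ^{2n}` as `(Λ × Λ)^n` along `pairIdx`. [folklore] -/
def pairSplit (α : Type*) (n : ℕ) : (Fin (2 * n) → α) ≃ (Fin n → α × α) :=
  ((Equiv.arrowCongr (pairIdx n) (Equiv.refl α)).symm.trans (Equiv.curry _ _ _)).trans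
    (Equiv.arrowCongr (Equiv.refl _) (finTwoArrowEquiv α))

/-- `pairSplit` sends `x` to the sequence of pairs `((x_{2j}, x_{2j+1}))_j`. [folklore] -/
theorem pairSplit_apply {α : Type*} (n : ℕ) (p : Fin (2 * n) → α) (j : Fin n) :
    pairSplit α n p j = (p (pairIdx n (j, 0)), p (pairIdx n (j, 1))) := rfl

/-- **Smearing Wick's law.** For weights `g` on a finite `Λ`,
`∑_{x ∈ Λ^{2n}} (∏ᵢ g(xᵢ)) 𝒢_n[S₂](x) = (2n)!/(2ⁿ n!) · (∑_{a,b ∈ Λ} g(a) g(b) S₂(a,b))ⁿ`: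
the smeared pairing functional is the `2n`-th moment of a centred Gaussian whose variance is
the smeared two-point function (the step between the first two displays of
Aizenman–Duminil-Copin 2021, §6.3, p. 26). [cite: AizenmanDuminilCopinAnnals2021, arXiv:1912.07973 §6.3 (p. 26)] -/
theorem sum_prod_mul_pairingSum {α : Type*} (Λ : Finset α) (g : α → ℝ)
    (S₂ : α → α → ℝ) (n : ℕ) :
    ∑ p ∈ Fintype.piFinset (fun _ : Fin (2 * n) => Λ), (∏ i, g (p i)) * pairingSum S₂ n p =
      ((2 * n)! : ℝ) / (2 ^ n * n !) * (∑ a ∈ Λ, ∑ b ∈ Λ, g a * g b * S₂ a b) ^ n := by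
  classical
  -- the unpermuted smeared product
  set Φ : (Fin (2 * n) → α) → ℝ := fun p =>
    (∏ i, g (p i)) * ∏ j : Fin n, S₂ (p (pairIdx n (j, 0))) (p (pairIdx n (j, 1))) with hΦ
  have base : ∑ p ∈ Fintype.piFinset (fun _ : Fin (2 * n) => Λ), Φ p =
      (∑ a ∈ Λ, ∑ b ∈ Λ, g a * g b * S₂ a b) ^ n := by
    have hprod : ∀ p : Fin (2 * n) → α, Φ p =
        ∏ j : Fin n, (g (p (pairIdx n (j, 0))) * g (p (pairIdx n (j, 1))) *
          S₂ (p (pairIdx n (j, 0))) (p (pairIdx n (j, 1)))) := by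
      intro p
      rw [hΦ]
      dsimp only
      rw [← Equiv.prod_comp (pairIdx n) (fun i => g (p i)), Fintype.prod_prod_type,
        ← Finset.prod_mul_distrib]
      refine Finset.prod_congr rfl fun j _ => ?_
      rw [Fin.prod_univ_two]
    simp_rw [hprod]
    rw [← Finset.sum_product', Finset.sum_pow']
    symm
    refine Finset.sum_equiv (pairSplit α n).symm (fun P => ?_) (fun P hP => ?_)
    · simp only [Fintype.mem_piFinset, Finset.mem_product]
      constructor
      · intro h i
        obtain ⟨⟨j, k⟩, rfl⟩ := (pairIdx n).surjective i
        have h1 : (pairSplit α n).symm P (pairIdx n (j, 0)) = (P j).1 := by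
          have := pairSplit_apply n ((pairSplit α n).symm P) j
          rw [Equiv.apply_symm_apply] at this
          exact (congrArg Prod.fst this).symm ▸ rfl
        have h2 : (pairSplit α n).symm P (pairIdx n (j, 1)) = (P j).2 := by
          have := pairSplit_apply n ((pairSplit α n).symm P) j
          rw [Equiv.apply_symm_apply] at this
          exact (congrArg Prod.snd this).symm ▸ rfl
        fin_cases k
        · simpa [h1] using (h j).1
        · simpa [h2] using (h j).2
      · intro h j
        have := pairSplit_apply n ((pairSplit α n).symm P) j
        rw [Equiv.apply_symm_apply] at this
        rw [this]
        exact ⟨h _, h _⟩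
    · refine Finset.prod_congr rfl fun j _ => ?_
      have := pairSplit_apply n ((pairSplit α n).symm P) j
      rw [Equiv.apply_symm_apply] at this
      rw [this]
  -- every ordering contributes the same smeared product
  have step : ∀ τ : Equiv.Perm (Fin (2 * n)),
      ∑ p ∈ Fintype.piFinset (fun _ : Fin (2 * n) => Λ),
        (∏ i, g (p i)) * ∏ j : Fin n, S₂ (p (τ (pairIdx n (j, 0)))) (p (τ (pairIdx n (j, 1)))) =
      (∑ a ∈ Λ, ∑ b ∈ Λ, g a * g b * S₂ a b) ^ n := by
    intro τ
    rw [← base, ← sum_piFinset_comp_perm Λ τ Φ]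
    refine Finset.sum_congr rfl fun p _ => ?_
    rw [hΦ]
    dsimp only [Function.comp_def]
    rw [Equiv.prod_comp τ (fun i => g (p i))]
  calc ∑ p ∈ Fintype.piFinset (fun _ : Fin (2 * n) => Λ), (∏ i, g (p i)) * pairingSum S₂ n p
      = ((2 : ℝ) ^ n * n !)⁻¹ * ∑ τ : Equiv.Perm (Fin (2 * n)),
          ∑ p ∈ Fintype.piFinset (fun _ : Fin (2 * n) => Λ),
            (∏ i, g (p i)) * ∏ j : Fin n,
              S₂ (p (τ (pairIdx n (j, 0)))) (p (τ (pairIdx n (j, 1)))) := by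
        simp only [pairingSum, Finset.mul_sum]
        rw [Finset.sum_comm]
        refine Finset.sum_congr rfl fun p _ => Finset.sum_congr rfl fun τ _ => ?_
        ring
    _ = ((2 * n)! : ℝ) / (2 ^ n * n !) * (∑ a ∈ Λ, ∑ b ∈ Λ, g a * g b * S₂ a b) ^ n := by
        simp_rw [step]
        rw [Finset.sum_const, Finset.card_univ, Fintype.card_perm, Fintype.card_fin, nsmul_eq_mul]
        ring

/-! #### Four-element subsets of the index set -/

variable {α : Type*} {n : ℕ}

/-- The complement of a `4`-subset of `{0,…,2n-1}` has `2n-4` elements. [folklore] -/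
theorem card_compl_of_card_eq_four (s : {s : Finset (Fin (2 * n)) // s.card = 4}) :
    s.1ᶜ.card = 2 * n - 4 := by
  rw [Finset.card_compl, Fintype.card_fin, s.2]

/-- For a `4`-subset `s = {i < j < k < l}` of the indices, the four points `(x_i, x_j, x_k, x_l)`
(in increasing order of index). [folklore] -/
def restrictFour (x : Fin (2 * n) → α) (s : {s : Finset (Fin (2 * n)) // s.card = 4}) :
    Fin 4 → α :=
  x ∘ s.1.orderEmbOfFin s.2

/-- For a `4`-subset `s` of the indices, the remaining `2n-4` points
`(x_1,…,x̸_i,…,x̸_j,…,x̸_k,…,x̸_l,…,x_{2n})` (in increasing order of index). [folklore] -/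
def removeFour (x : Fin (2 * n) → α) (s : {s : Finset (Fin (2 * n)) // s.card = 4}) :
    Fin (2 * n - 4) → α :=
  x ∘ s.1ᶜ.orderEmbOfFin (card_compl_of_card_eq_four s)

/-- The identification `Fin (2n-4) ⊕ Fin 4 ≃ Fin (2n)` enumerating increasingly first the
complement of a `4`-subset `s`, then `s`. [folklore] -/
def splitEquiv (s : {s : Finset (Fin (2 * n)) // s.card = 4}) : Fin (2 * n - 4) ⊕ Fin 4 ≃ Fin (2 * n) :=
  (Equiv.sumCongr (s.1ᶜ.orderIsoOfFin (card_compl_of_card_eq_four s)).toEquiv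
      (s.1.orderIsoOfFin s.2).toEquiv).trans <|
    (Equiv.sumComm _ _).trans <|
      (Equiv.sumCongr (Equiv.refl _) (Equiv.subtypeEquivRight fun _ => Finset.mem_compl)).trans
        (Equiv.sumCompl fun i : Fin (2 * n) => i ∈ s.1)

/-- On the left summand `splitEquiv s` is the increasing enumeration of the complement of `s`. [folklore] -/
theorem splitEquiv_inl (s : {s : Finset (Fin (2 * n)) // s.card = 4}) (j : Fin (2 * n - 4)) :
    splitEquiv s (Sum.inl j) = s.1ᶜ.orderEmbOfFin (card_compl_of_card_eq_four s) j := by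
  simp [splitEquiv]

/-- On the right summand `splitEquiv s` is the increasing enumeration of `s`. [folklore] -/
theorem splitEquiv_inr (s : {s : Finset (Fin (2 * n)) // s.card = 4}) (j : Fin 4) :
    splitEquiv s (Sum.inr j) = s.1.orderEmbOfFin s.2 j := by
  simp [splitEquiv]

/-- `removeFour` in terms of `splitEquiv`. [folklore] -/
theorem removeFour_eq (x : Fin (2 * n) → α) (s : {s : Finset (Fin (2 * n)) // s.card = 4}) :
    removeFour x s = fun j => x (splitEquiv s (Sum.inl j)) := by
  funext j; rw [splitEquiv_inl]; rfl

/-- `restrictFour` in terms of `splitEquiv`. [folklore] -/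
theorem restrictFour_eq (x : Fin (2 * n) → α) (s : {s : Finset (Fin (2 * n)) // s.card = 4}) :
    restrictFour x s = fun j => x (splitEquiv s (Sum.inr j)) := by
  funext j; rw [splitEquiv_inr]; rfl

/-- There are `C(2n, 4) ≤ (2n)⁴` four-element subsets of the indices. [folklore] -/
theorem card_fourSubsets_le : (Fintype.card {s : Finset (Fin (2 * n)) // s.card = 4} : ℝ) ≤ (2 * n : ℝ) ^ 4 := by
  rw [Fintype.card_finset_len, Fintype.card_fin]
  exact_mod_cast Nat.choose_le_pow (2 * n) 4

/-- **Smearing the removed-points term.** For weights `w` on `Λ` and every `4`-subset `s`,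
`∑_{x ∈ Λ^{2n}} (∏ᵢ w(xᵢ)) F(x^{(s̸)}) G(x_s) = (∑_{q ∈ Λ^{2n-4}} (∏ w) F(q)) (∑_{u ∈ Λ⁴} (∏ w) G(u))`. [folklore] -/
theorem sum_prod_mul_removeFour_mul_restrictFour (Λ : Finset α) (w : α → ℝ)
    (F : (Fin (2 * n - 4) → α) → ℝ) (G : (Fin 4 → α) → ℝ)
    (s : {s : Finset (Fin (2 * n)) // s.card = 4}) :
    ∑ p ∈ Fintype.piFinset (fun _ : Fin (2 * n) => Λ),
        (∏ i, w (p i)) * (F (removeFour p s) * G (restrictFour p s)) =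
      (∑ q ∈ Fintype.piFinset (fun _ : Fin (2 * n - 4) => Λ), (∏ j, w (q j)) * F q) *
        ∑ u ∈ Fintype.piFinset (fun _ : Fin 4 => Λ), (∏ j, w (u j)) * G u := by
  rw [← sum_piFinset_split Λ (splitEquiv s)]
  refine Finset.sum_congr rfl fun p _ => ?_
  rw [removeFour_eq, restrictFour_eq, ← Equiv.prod_comp (splitEquiv s) (fun i => w (p i)),
    Fintype.prod_sum_type]
  ring

end Literature.Probability.LatticeModels

namespace Literature.Probability.LatticeModels

open MeasureTheory Finset Filter Topology
open scoped Nat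
open Percolation

variable {d : ℕ}

/-! ### Part J. Aizenman's inequality (the first display of ADC §6.3) as named facts

The lower half (`PairingLowerBound`, `aizenman_nPoint_le_pairingSum`) is Newman's Gaussian
inequality, discharged in the tree. The upper half **as quoted by ADC** (`PairingUpperBound`,
`aizenman_pairingSum_sub_nPoint_le`; the `S_{2n-4}` form) is false and retired (2026-08-15; module
docstring, §Correction); the source form (Aizenman 1982, Prop. 12.1: `𝒢_{n-2}[S₂]` of the
remaining points) is `WickDeviationBound` / `aizenman_wickDeviation_le_finite` of
`AizenmanWickBound`. -/

/-- **The lower half of Aizenman's inequality for one state `μ`** (Gaussian domination of the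
`2n`-point functions): for all `n ≥ 2` and `x₁,…,x_{2n}`,
`⟨σ_{x₁} ⋯ σ_{x_{2n}}⟩_μ ≤ 𝒢_n[⟨σ_· σ_·⟩_μ](x₁,…,x_{2n})` (the lower inequality
`0 ≤ 𝒢_n[S] - S_{2n}` of the first display of Aizenman–Duminil-Copin 2021, §6.3, p. 26, as a
property of a state). [cite: AizenmanDuminilCopinAnnals2021, arXiv:1912.07973 §6.3, first display, lower inequality (p. 26)] -/
def PairingLowerBound (μ : Measure (SpinConfig (Site d))) : Prop :=
  ∀ n : ℕ, 2 ≤ n → ∀ x : Fin (2 * n) → Site d,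
    nPoint μ spinAt x ≤ pairingSum (twoPoint μ spinAt) n x

/-- **The upper inequality AS QUOTED by Aizenman–Duminil-Copin 2021, §6.3 (the `S_{2n-4}`
form), for one state `μ`**: for all `n ≥ 2` and `x₁,…,x_{2n}`,
`𝒢_n[S](x) - S_{2n}(x) ≤ -(3/2) ∑_{1≤i<j<k<l≤2n} S_{2n-4}(x₁,…,x̸_i,…,x̸_j,…,x̸_k,…,x̸_l,…,x_{2n})
U₄(x_i,x_j,x_k,x_l)` (the upper inequality of the first display of ADC 2021, §6.3 — eq. (6.44),
p. 42 of the held arXiv text; journal p. 26 — read as a property of a state; the sum runs over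
the `4`-element subsets `s` of the index set, `removeFour x s` are the remaining points and
`restrictFour x s` the selected ones, both in increasing order of index; `U₄ = connectedFour` of
`Correlations`). **Not a theorem about any state**: ADC's display misquotes Aizenman 1982,
Prop. 12.1, eq. (12.3) (= Aizenman CDM 2020, Prop. 7.2, eq. (7.1); Panis 2023, Prop. 4.6), whose
right-hand side has the Wick functional `𝒢_{n-2}[S₂]` of the remaining points in place of
`S_{2n-4}` — that source form is `WickDeviationBound μ` of `AizenmanWickBound` — and the
`S_{2n-4}` form holds for **no** probability measure on `{±1}^{ℤ^d}` (`not_pairingUpperBound` of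
`AizenmanWickBoundLocal`: at ten coincident points it reads `944 ≤ 630`). The predicate keeps its
body (verdict clean-up 2026-08-15) as the hypothesis shape of those refutation theorems and of
the vacuous theorems below; see the module docstring, §Correction. [cite: AizenmanDuminilCopinAnnals2021, arXiv:1912.07973 §6.3, eq. (6.44), upper inequality as printed there (p. 42; journal p. 26) — a misquotation of AizenmanCMP1982 Prop. 12.1] -/
def PairingUpperBound (μ : Measure (SpinConfig (Site d))) : Prop :=
  ∀ n : ℕ, 2 ≤ n → ∀ x : Fin (2 * n) → Site d,
    pairingSum (twoPoint μ spinAt) n x - nPoint μ spinAt x ≤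
      -(3 / 2) * ∑ s : {s : Finset (Fin (2 * n)) // s.card = 4},
        nPoint μ spinAt (removeFour x s) * connectedFour μ spinAt (restrictFour x s)

/-- **Gaussian domination of the `2n`-point function** (the lower inequality
`0 ≤ 𝒢_n[S_β](x₁,…,x_{2n}) - S_β(x₁,…,x_{2n})` of the first display of Aizenman–Duminil-Copin
2021, §6.3, p. 26, "valid for every `n ≥ 2` and derived using the switching lemma in [Aiz82]";
Newman 1975; restated in Panis 2023, Prop. 4.6, `d ≥ 2`). For the nearest-neighbour
ferromagnetic Ising model on `ℤ^d`, `d ≥ 2`, `0 ≤ β ≤ β_c`, the DLR state `μ ∈ 𝒢(β, 0)`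
(a singleton), `n ≥ 2` and all `x₁, …, x_{2n} ∈ ℤ^d`,
`⟨σ_{x₁} ⋯ σ_{x_{2n}}⟩_μ ≤ 𝒢_n[⟨σ_· σ_·⟩_μ](x₁,…,x_{2n})` (`nPoint`, `twoPoint` of
`Correlations`; `pairingSum` above). Named fact (D-0014). [cite: AizenmanDuminilCopinAnnals2021, arXiv:1912.07973 §6.3, first display, lower inequality (p. 26)] [cite: Panis2023Triviality, Prop. 4.6] -/
def aizenman_nPoint_le_pairingSum : Prop :=
  ∀ {d : ℕ}, 2 ≤ d → ∀ β : ℝ, 0 ≤ β → β ≤ criticalBeta d → ∀ μ ∈ isingGibbsMeasures d β 0,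
    PairingLowerBound μ

/-- **RETIRED — refuted as stated (verdict clean-up 2026-08-15); not literature debt, no
`aizenman_pairingSum_sub_nPoint_le_holds` can exist.** The record: the upper inequality of the
first display of Aizenman–Duminil-Copin 2021, §6.3 (eq. (6.44), p. 42 of the held arXiv text;
journal p. 26), *as printed there* — `𝒢_n[S_β](x₁,…,x_{2n}) - S_β(x₁,…,x_{2n}) ≤
-(3/2) ∑_{1 ≤ i<j<k<l ≤ 2n} S_β(x₁,…,x̸_i,…,x̸_j,…,x̸_k,…,x̸_l,…,x_{2n}) U₄^β(x_i,x_j,x_k,x_l)` —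
asserted for the nearest-neighbour Ising model on `ℤ^d`, `d ≥ 2`, `0 ≤ β ≤ β_c`, every
`μ ∈ 𝒢(β, 0)` (`PairingUpperBound μ`). **Refuted in the tree**:
`Literature.Probability.LatticeModels.not_aizenman_pairingSum_sub_nPoint_le`
(`AizenmanWickBoundRefutations`: `𝒢(0,0)` on `ℤ²` contains the free state, and
`PairingUpperBound` fails for every probability measure at ten coincident points,
`not_pairingUpperBound` of `AizenmanWickBoundLocal`). **What was wrong**: ADC's display
misquotes its source, M. Aizenman, Comm. Math. Phys. 86 (1982), Prop. 12.1, eq. (12.3) —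
restated verbatim in Aizenman, CDM 2020 (arXiv:2112.04248), Prop. 7.2, eq. (7.1), p. 23, and in
Panis 2023, Prop. 4.6, p. 20 — whose right-hand side is
`(3/2) ∑ |U₄(x_j,x_k,x_l,x_m)| · G_{2n-4}[S₂](…)` with the **Wick functional**
`G_{2n-4} = 𝒢_{n-2}[S₂]` of the remaining points, not their correlation `S_{2n-4}`; with
`S_{2n-4}` the inequality fails at coincident points. **Corrected statement** (not re-declared
here, it exists in the tree): the state property `WickDeviationBound μ` of `AizenmanWickBound`,
established for every state with the free correlations by `wickDeviationBound_of_finite` /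
`pairingLowerBound_and_wickDeviationBound_of_freeCorr` from the finite-volume theorem
`aizenman_wickDeviation_le_finite` (proved: `aizenman_wickDeviation_le_finite_holds`,
`AizenmanWickBoundProofs`); the DLR-state consequences are
`aizenmanDuminilCopin_mgf_normalizedField_bound_abs_of_wickDeviation` (`AizenmanWickBound`) and
`isGaussianProcess_…_printRegime_of_wickDeviation` (`HighDimTrivialityProofs`). Kept as a
`@[deprecated]` record only because its refutation and the vacuous theorems
`aizenman_evenMoment_deviation_le_of_pointwise`, `…_printRegime_of_pointwise` below name it. [cite: AizenmanDuminilCopinAnnals2021, arXiv:1912.07973 §6.3, eq. (6.44), upper inequality as printed (p. 42; journal p. 26) — misquoting AizenmanCMP1982 Prop. 12.1, eq. (12.3)] -/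
@[deprecated "refuted as stated: see Literature.Probability.LatticeModels.not_aizenman_pairingSum_sub_nPoint_le (AizenmanWickBoundRefutations.lean); the quoted S_{2n-4} form of ADC 2021 (6.44) is not Aizenman 1982 Prop. 12.1, which has the Wick functional 𝒢_{n-2}[S₂] of the remaining points; corrected statement: Literature.Probability.LatticeModels.WickDeviationBound (with wickDeviationBound_of_finite) from aizenman_wickDeviation_le_finite (AizenmanWickBound.lean; proved in AizenmanWickBoundProofs.lean)" (since := "2026-08-15")]
def aizenman_pairingSum_sub_nPoint_le : Prop :=
  ∀ {d : ℕ}, 2 ≤ d → ∀ β : ℝ, 0 ≤ β → β ≤ criticalBeta d → ∀ μ ∈ isingGibbsMeasures d β 0,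
    PairingUpperBound μ

/-- **Aizenman's inequality in finite volume, lower half.** For the nearest-neighbour
ferromagnetic Ising model in a finite volume `Λ ⊂ ℤ^d` with free boundary condition, zero field
and `β ≥ 0` (the finite Gibbs measure `isingMeasure (zdGraph d) Λ β 0 free`), `n ≥ 2` and
`x₁,…,x_{2n} ∈ Λ`: `⟨σ_{x₁} ⋯ σ_{x_{2n}}⟩_{Λ,β} ≤ 𝒢_n[⟨σ_·σ_·⟩_{Λ,β}](x₁,…,x_{2n})`. This is
the finite-volume form in which the switching-lemma argument of [Aiz82] (Aizenman, Comm. Math.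
Phys. 86 (1982); the switching lemma is a finite-volume identity, Panis 2023, Lemma 4.4)
establishes the first display of Aizenman–Duminil-Copin 2021, §6.3, p. 26, before the passage
to the infinite-volume state `S_β` (performed below: `pairingLowerBound_of_finite`). Named fact
(D-0014). [cite: AizenmanDuminilCopinAnnals2021, arXiv:1912.07973 §6.3, first display, lower inequality (p. 26), finite-volume form] [cite: Panis2023Triviality, Prop. 4.6 with Lemma 4.4] -/
def aizenman_nPoint_le_pairingSum_finite : Prop :=
  ∀ {d : ℕ} (Λ : Finset (Site d)) (β : ℝ), 0 ≤ β → ∀ n : ℕ, 2 ≤ n →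
    ∀ x : Fin (2 * n) → Site d, (∀ i, x i ∈ Λ) →
      nPoint (isingMeasure (zdGraph d) Λ β 0 .free) spinAt x ≤
        pairingSum (twoPoint (isingMeasure (zdGraph d) Λ β 0 .free) spinAt) n x

/-- **RETIRED — refuted as stated (verdict clean-up 2026-08-15); not literature debt, no
`aizenman_pairingSum_sub_nPoint_le_finite_holds` can exist.** The record: the finite-volume
form of the upper inequality of ADC 2021, §6.3, first display (eq. (6.44), p. 42 of the held
arXiv text; journal p. 26) *as printed there*, in the setting of
`aizenman_nPoint_le_pairingSum_finite` (finite `Λ ⊂ ℤ^d`, free boundary condition, zero field,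
`β ≥ 0`, `n ≥ 2`, `x₁,…,x_{2n} ∈ Λ`):
`𝒢_n[⟨σσ⟩_{Λ,β}](x) - ⟨σ_{x₁}⋯σ_{x_{2n}}⟩_{Λ,β}
  ≤ -(3/2) ∑_{1≤i<j<k<l≤2n} ⟨∏_{m ∉ {i,j,k,l}} σ_{x_m}⟩_{Λ,β} U₄^{Λ,β}(x_i,x_j,x_k,x_l)`.
**Refuted in the tree**:
`Literature.Probability.LatticeModels.not_aizenman_pairingSum_sub_nPoint_le_finite`
(`AizenmanWickBoundLocal`: `Λ = {0} ⊂ ℤ¹`, `β = 0`, ten coincident points, where it reads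
`944 ≤ 630`; `not_pairingUpperBound_at_zero`). **What was wrong**: the `(2n-4)`-point function
`⟨∏_{m ∉ {i,j,k,l}} σ_{x_m}⟩` on the right is ADC's misquotation of Aizenman 1982, Prop. 12.1,
eq. (12.3) (= Aizenman CDM 2020, Prop. 7.2, eq. (7.1), p. 23; Panis 2023, Prop. 4.6, p. 20),
which has there the Wick functional `G_{2n-4} = 𝒢_{n-2}[⟨σσ⟩_{Λ,β}]` of the remaining points
(and `|U₄|`). **Corrected statement** (not re-declared here, it exists in the tree):
`aizenman_wickDeviation_le_finite` of `AizenmanWickBound` — Aizenman's Prop. 12.1 on every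
finite graph with free boundary condition and zero field, `|S_{2n} - 𝒢_n[S₂]| ≤ (3/2) R_{2n}`
with `R_{2n} = wickRemainder` — a theorem of the tree (`aizenman_wickDeviation_le_finite_holds`,
`AizenmanWickBoundProofs`); its box form is `wickDeviation_le_box` and its passage to the limit
`wickDeviationBound_of_finite`. Kept as a `@[deprecated]` record only because its refutation,
the vacuous theorems of Parts M–N below and the importers
`Literature/Barriers/CriticalPhenomena/IsingTrivialityFromDimensionFour{Proofs,HighDim}` name it. [cite: AizenmanDuminilCopinAnnals2021, arXiv:1912.07973 §6.3, eq. (6.44), upper inequality as printed (p. 42; journal p. 26), finite-volume form — misquoting AizenmanCMP1982 Prop. 12.1, eq. (12.3)] -/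
@[deprecated "refuted as stated: see Literature.Probability.LatticeModels.not_aizenman_pairingSum_sub_nPoint_le_finite (AizenmanWickBoundLocal.lean); the quoted S_{2n-4} form of ADC 2021 (6.44) is not Aizenman 1982 Prop. 12.1, which has the Wick functional 𝒢_{n-2}[S₂] of the remaining points; corrected statement: Literature.Probability.LatticeModels.aizenman_wickDeviation_le_finite (AizenmanWickBound.lean; proved: aizenman_wickDeviation_le_finite_holds, AizenmanWickBoundProofs.lean)" (since := "2026-08-15")]
def aizenman_pairingSum_sub_nPoint_le_finite : Prop :=
  ∀ {d : ℕ} (Λ : Finset (Site d)) (β : ℝ), 0 ≤ β → ∀ n : ℕ, 2 ≤ n →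
    ∀ x : Fin (2 * n) → Site d, (∀ i, x i ∈ Λ) →
      pairingSum (twoPoint (isingMeasure (zdGraph d) Λ β 0 .free) spinAt) n x -
          nPoint (isingMeasure (zdGraph d) Λ β 0 .free) spinAt x ≤
        -(3 / 2) * ∑ s : {s : Finset (Fin (2 * n)) // s.card = 4},
          nPoint (isingMeasure (zdGraph d) Λ β 0 .free) spinAt (removeFour x s) *
            connectedFour (isingMeasure (zdGraph d) Λ β 0 .free) spinAt (restrictFour x s)

/-! ### Part K. Smearing: the moment-level facts from Aizenman's inequality -/

/-- Sums over `Λ²` as double sums. [folklore] -/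
theorem sum_piFinset_fin_two {α : Type*} (Λ : Finset α) (F : (Fin 2 → α) → ℝ) :
    ∑ p ∈ Fintype.piFinset (fun _ : Fin 2 => Λ), F p = ∑ a ∈ Λ, ∑ b ∈ Λ, F ![a, b] := by
  rw [← Finset.sum_product']
  refine Finset.sum_equiv (finTwoArrowEquiv α) (fun p => ?_) (fun p _ => ?_)
  · simp [Fintype.mem_piFinset, Fin.forall_fin_two]
  · simp only [finTwoArrowEquiv_apply]
    congr 1
    ext i
    fin_cases i <;> rfl

/-- **The second moment as a smeared two-point function**:
`⟨T_{f,L}²⟩ = Σ_L⁻¹ ∑_{a,b ∈ Λ} f(a/L) f(b/L) ⟨σ_a σ_b⟩`. [cite: AizenmanDuminilCopinAnnals2021, arXiv:1912.07973 §6.3 (p. 26)] -/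
theorem integral_normalizedField_sq_eq_sum₂ (μ : Measure (SpinConfig (Site d))) [IsFiniteMeasure μ]
    {f : EuclideanSpace ℝ (Fin d) → ℝ} {r L : ℝ} (hL : L ≠ 0)
    (hf : ∀ x, f x ≠ 0 → ∀ i, |x i| ≤ r) :
    ∫ σ, normalizedField μ L f σ ^ 2 ∂μ =
      (Real.sqrt (blockSpinVariance μ L))⁻¹ ^ 2 *
        ∑ a ∈ latticeBox d (r / |L⁻¹|), ∑ b ∈ latticeBox d (r / |L⁻¹|),
          f (L⁻¹ • siteVec a) * f (L⁻¹ • siteVec b) * twoPoint μ spinAt a b := by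
  rw [integral_normalizedField_pow μ hL hf 2, sum_piFinset_fin_two]
  congr 1
  refine Finset.sum_congr rfl fun a _ => Finset.sum_congr rfl fun b _ => ?_
  simp [Fin.prod_univ_two, twoPoint, mul_assoc]

/-- **The deviation of the even moments from Wick's law as a smeared sum**:
`⟨T_{f,L}^{2n}⟩ - (2n)!/(2ⁿn!) ⟨T_{f,L}²⟩ⁿ = Σ_L^{-n} ∑_{x ∈ Λ^{2n}} ∏ f(xᵢ/L) (S_{2n}(x) - 𝒢_n[S₂](x))`
(Aizenman–Duminil-Copin 2021, §6.3, p. 26, from the first to the second display). [cite: AizenmanDuminilCopinAnnals2021, arXiv:1912.07973 §6.3 (p. 26)] -/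
theorem integral_normalizedField_pow_sub_wick (μ : Measure (SpinConfig (Site d)))
    [IsFiniteMeasure μ] {f : EuclideanSpace ℝ (Fin d) → ℝ} {r L : ℝ} (hL : L ≠ 0)
    (hf : ∀ x, f x ≠ 0 → ∀ i, |x i| ≤ r) (n : ℕ) :
    (∫ σ, normalizedField μ L f σ ^ (2 * n) ∂μ) -
        ((2 * n)! : ℝ) / (2 ^ n * n !) * (∫ σ, normalizedField μ L f σ ^ 2 ∂μ) ^ n =
      (Real.sqrt (blockSpinVariance μ L))⁻¹ ^ (2 * n) *
        ∑ p ∈ Fintype.piFinset (fun _ : Fin (2 * n) => latticeBox d (r / |L⁻¹|)),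
          (∏ i, f (L⁻¹ • siteVec (p i))) *
            (nPoint μ spinAt p - pairingSum (twoPoint μ spinAt) n p) := by
  rw [integral_normalizedField_pow μ hL hf (2 * n), integral_normalizedField_sq_eq_sum₂ μ hL hf,
    mul_pow, ← pow_mul]
  simp_rw [mul_sub]
  rw [Finset.sum_sub_distrib,
    sum_prod_mul_pairingSum (latticeBox d (r / |L⁻¹|)) (fun a => f (L⁻¹ • siteVec a))
      (twoPoint μ spinAt) n]
  simp only [nPoint]
  ring

/-- **Gaussian domination of the even moments, one state.** If `μ` satisfies the lower half of
Aizenman's inequality (`PairingLowerBound μ`), then for `L > 0`, every non-negative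
`f ∈ C_0(ℝ^d)` and every `n`, `⟨T_{f,L}^{2n}⟩_μ ≤ (2n)!/(2ⁿ n!) ⟨T_{f,L}²⟩_μⁿ` (for `f ≥ 0` the
weights `∏ f(xᵢ/L)` are non-negative, so the pointwise inequality may be smeared; `n ≤ 1` is an
identity) (Aizenman–Duminil-Copin 2021, §6.3, p. 26). [cite: AizenmanDuminilCopinAnnals2021, arXiv:1912.07973 §6.3, first display (p. 26)] -/
theorem integral_normalizedField_pow_le_of_pairingLowerBound
    {μ : Measure (SpinConfig (Site d))} [IsProbabilityMeasure μ] (hlow : PairingLowerBound μ)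
    {L : ℝ} (hL : 0 < L) {f : EuclideanSpace ℝ (Fin d) → ℝ} (hfs : HasCompactSupport f)
    (hf0 : ∀ x, 0 ≤ f x) (n : ℕ) :
    ∫ σ, normalizedField μ L f σ ^ (2 * n) ∂μ ≤
      ((2 * n)! : ℝ) / (2 ^ n * n !) * (∫ σ, normalizedField μ L f σ ^ 2 ∂μ) ^ n := by
  have hLne : L ≠ 0 := hL.ne'
  obtain ⟨r, -, hfr⟩ := exists_cube_of_hasCompactSupport f hfs
  rcases Nat.lt_or_ge n 2 with hn | hn
  · interval_cases n
    · simp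
    · simp
  · have key := integral_normalizedField_pow_sub_wick μ hLne hfr n
    have hle : (Real.sqrt (blockSpinVariance μ L))⁻¹ ^ (2 * n) *
        ∑ p ∈ Fintype.piFinset (fun _ : Fin (2 * n) => latticeBox d (r / |L⁻¹|)),
          (∏ i, f (L⁻¹ • siteVec (p i))) *
            (nPoint μ spinAt p - pairingSum (twoPoint μ spinAt) n p) ≤ 0 := by
      refine mul_nonpos_of_nonneg_of_nonpos (pow_nonneg (inv_nonneg.mpr (Real.sqrt_nonneg _)) _)
        (Finset.sum_nonpos fun p _ => mul_nonpos_of_nonneg_of_nonpos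
          (Finset.prod_nonneg fun i _ => hf0 _) ?_)
      exact sub_nonpos.mpr (hlow n hn p)
    linarith

/-- **Gaussian domination of the even moments from the pointwise inequality**:
`aizenman_nPoint_le_pairingSum` implies `newman_evenMoment_le`. [cite: AizenmanDuminilCopinAnnals2021, arXiv:1912.07973 §6.3, first display (p. 26)] -/
theorem newman_evenMoment_le_of_pointwise (hlow : aizenman_nPoint_le_pairingSum) :
    newman_evenMoment_le := by
  intro d hd β L hβ hβc hL μ hμ f hf hfs hf0 n
  haveI : IsProbabilityMeasure μ := hμ.1
  exact integral_normalizedField_pow_le_of_pairingLowerBound (hlow hd β hβ hβc μ hμ) hL hfs hf0 n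

/-- The moments `⟨T_{f,L}^{2k}⟩` of the normalised field are non-negative. [folklore] -/
theorem integral_normalizedField_even_pow_nonneg (μ : Measure (SpinConfig (Site d))) (L : ℝ)
    (f : EuclideanSpace ℝ (Fin d) → ℝ) (k : ℕ) :
    0 ≤ ∫ σ, normalizedField μ L f σ ^ (2 * k) ∂μ :=
  integral_nonneg fun _ => (even_two_mul k).pow_nonneg _

/-- **The deviation from Wick's law, one state** (vacuous since 2026-08-15: no probability
measure satisfies `PairingUpperBound`, `not_pairingUpperBound`; the source-form version is
`abs_integral_normalizedField_pow_sub_le_of_wickBounds` of `AizenmanWickBound`, resp.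
`…_of_wickDeviationBoundOn` of `AizenmanWickBoundLocal`; kept because importers name it).
If `μ` satisfies both halves of the quoted inequality (`PairingLowerBound μ`,
`PairingUpperBound μ`), then for `L > 0`,
`f ∈ C_0(ℝ^d)` vanishing outside `[-r,r]^d` and `n ≥ 2`,
`|⟨T_{f,L}^{2n}⟩ - (2n)!/(2ⁿn!) ⟨T_{f,L}²⟩ⁿ| ≤ (3/2)(2n)⁴ ⟨T_{|f|,L}^{2n-4}⟩ ‖f‖_∞⁴ S(μ; L, r)`:
multiply the pointwise inequality by `∏ᵢ f(xᵢ/L)`, move absolute values inside using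
`𝒢_n - S_{2n} ≥ 0`, and factor the sum over `x ∈ Λ^{2n}` along each `4`-subset of the indices
(`C(2n,4) ≤ (2n)⁴`) (Aizenman–Duminil-Copin 2021, §6.3, p. 26, from the first to the second
display; Panis 2023, proof of Thm 5.5, first display). [cite: AizenmanDuminilCopinAnnals2021, arXiv:1912.07973 §6.3, first two displays (p. 26)] -/
theorem abs_integral_normalizedField_pow_sub_le_of_pairingBounds
    {μ : Measure (SpinConfig (Site d))} [IsProbabilityMeasure μ] (hlow : PairingLowerBound μ)
    (hup : PairingUpperBound μ) {L r : ℝ} (hL : 0 < L)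
    {f : EuclideanSpace ℝ (Fin d) → ℝ} (hf : Continuous f) (hfr : ∀ x, f x ≠ 0 → ∀ i, |x i| ≤ r)
    {n : ℕ} (hn : 2 ≤ n) :
    |(∫ σ, normalizedField μ L f σ ^ (2 * n) ∂μ) -
        ((2 * n)! : ℝ) / (2 ^ n * n !) * (∫ σ, normalizedField μ L f σ ^ 2 ∂μ) ^ n|
      ≤ 3 / 2 * (2 * n : ℝ) ^ 4 *
          (∫ σ, normalizedField μ L (fun x => |f x|) σ ^ (2 * n - 4) ∂μ) *
          (⨆ x, |f x|) ^ 4 * ursellFourSum μ L r := by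
  have hLne : L ≠ 0 := hL.ne'
  have hfar : ∀ x, (fun y => |f y|) x ≠ 0 → ∀ i, |x i| ≤ r := fun x hx =>
    hfr x (abs_ne_zero.mp hx)
  have hbox : latticeBox d (r / |L⁻¹|) = latticeBox d (r * L) := by
    rw [abs_inv, abs_of_pos hL, div_inv_eq_mul]
  -- notation
  set Λ : Finset (Site d) := latticeBox d (r / |L⁻¹|) with hΛ
  set c : ℝ := (Real.sqrt (blockSpinVariance μ L))⁻¹ with hc
  set g : Site d → ℝ := fun a => f (L⁻¹ • siteVec a) with hg
  set G : (Fin (2 * n) → Site d) → ℝ := fun p => pairingSum (twoPoint μ spinAt) n p with hG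
  set U : (Fin 4 → Site d) → ℝ := fun u => connectedFour μ spinAt u with hU
  set A : ℝ := ∑ q ∈ Fintype.piFinset (fun _ : Fin (2 * n - 4) => Λ),
    (∏ j, |g (q j)|) * nPoint μ spinAt q with hA
  set B : ℝ := ∑ u ∈ Fintype.piFinset (fun _ : Fin 4 => Λ), (∏ j, |g (u j)|) * U u with hB
  set Us : ℝ := ∑ u ∈ Fintype.piFinset (fun _ : Fin 4 => Λ), |U u| with hUs
  set M : ℝ := ⨆ x, |f x| with hM
  have hM0 : 0 ≤ M := iSup_abs_nonneg f
  have hgM : ∀ a, |g a| ≤ M := by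
    have hbdd : BddAbove (Set.range fun x => |f x|) :=
      (hf.abs).bddAbove_range_of_hasCompactSupport
        ((hasCompactSupport_of_cube hfr).comp_left abs_zero)
    intro a
    exact le_ciSup hbdd _
  have hc0 : 0 ≤ c := inv_nonneg.mpr (Real.sqrt_nonneg _)
  have hSig0 : 0 ≤ blockSpinVariance μ L := integral_nonneg fun σ => sq_nonneg _
  -- the moments of `T_{|f|,L}` and the sum of `|U₄|`
  have hmomY : ∫ σ, normalizedField μ L (fun x => |f x|) σ ^ (2 * n - 4) ∂μ = c ^ (2 * n - 4) * A := by
    rw [integral_normalizedField_pow μ hLne hfar (2 * n - 4)]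
    rfl
  have hmomY0 : 0 ≤ ∫ σ, normalizedField μ L (fun x => |f x|) σ ^ (2 * n - 4) ∂μ := by
    obtain ⟨k, hk⟩ : ∃ k, 2 * n - 4 = 2 * k := ⟨n - 2, by omega⟩
    rw [hk]
    exact integral_normalizedField_even_pow_nonneg μ L _ k
  have hS : ursellFourSum μ L r = Us / blockSpinVariance μ L ^ 2 := by
    rw [ursellFourSum, hUs, hbox]
  have hS0 : 0 ≤ ursellFourSum μ L r := ursellFourSum_nonneg μ L r
  have hB : -B ≤ M ^ 4 * Us := by
    rw [hB, hUs, Finset.mul_sum, ← Finset.sum_neg_distrib]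
    refine Finset.sum_le_sum fun u _ => ?_
    have hprod : ∏ j, |g (u j)| ≤ M ^ 4 := by
      calc ∏ j, |g (u j)| ≤ ∏ _j : Fin 4, M :=
            Finset.prod_le_prod (fun j _ => abs_nonneg _) fun j _ => hgM _
        _ = M ^ 4 := by rw [Finset.prod_const, Finset.card_univ, Fintype.card_fin]
    have h0 : 0 ≤ ∏ j, |g (u j)| := Finset.prod_nonneg fun j _ => abs_nonneg _
    calc -((∏ j, |g (u j)|) * U u) ≤ (∏ j, |g (u j)|) * |U u| := by
          rw [← mul_neg]; exact mul_le_mul_of_nonneg_left (neg_le_abs _) h0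
      _ ≤ M ^ 4 * |U u| := mul_le_mul_of_nonneg_right hprod (abs_nonneg _)
  -- the right-hand side is non-negative
  have hRHS0 : 0 ≤ 3 / 2 * (2 * n : ℝ) ^ 4 *
      (∫ σ, normalizedField μ L (fun x => |f x|) σ ^ (2 * n - 4) ∂μ) * M ^ 4 *
        ursellFourSum μ L r :=
    mul_nonneg (mul_nonneg (mul_nonneg (by positivity) hmomY0) (pow_nonneg hM0 4)) hS0
  -- Step 1: the deviation identity and the pointwise bounds
  rw [integral_normalizedField_pow_sub_wick μ hLne hfr n, ← hc, ← hΛ]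
  have hdev : ∀ p : Fin (2 * n) → Site d,
      0 ≤ G p - nPoint μ spinAt p ∧
        G p - nPoint μ spinAt p ≤ -(3 / 2) * ∑ s : {s : Finset (Fin (2 * n)) // s.card = 4},
          nPoint μ spinAt (removeFour p s) * U (restrictFour p s) := fun p =>
    ⟨sub_nonneg.mpr (hlow n hn p), hup n hn p⟩
  -- Step 2: absolute values inside, pointwise bound, and factorisation along each 4-subset
  have hsum : |∑ p ∈ Fintype.piFinset (fun _ : Fin (2 * n) => Λ),
      (∏ i, g (p i)) * (nPoint μ spinAt p - G p)| ≤
      -(3 / 2) * ((Fintype.card {s : Finset (Fin (2 * n)) // s.card = 4} : ℝ) * (A * B)) := by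
    calc |∑ p ∈ Fintype.piFinset (fun _ : Fin (2 * n) => Λ),
          (∏ i, g (p i)) * (nPoint μ spinAt p - G p)|
        ≤ ∑ p ∈ Fintype.piFinset (fun _ : Fin (2 * n) => Λ),
            (∏ i, |g (p i)|) * (G p - nPoint μ spinAt p) := by
          refine (Finset.abs_sum_le_sum_abs _ _).trans (le_of_eq (Finset.sum_congr rfl fun p _ => ?_))
          rw [abs_mul, Finset.abs_prod, ← abs_neg, neg_sub, abs_of_nonneg (hdev p).1]
      _ ≤ ∑ p ∈ Fintype.piFinset (fun _ : Fin (2 * n) => Λ),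
            (∏ i, |g (p i)|) * (-(3 / 2) * ∑ s : {s : Finset (Fin (2 * n)) // s.card = 4},
              nPoint μ spinAt (removeFour p s) * U (restrictFour p s)) :=
          Finset.sum_le_sum fun p _ => mul_le_mul_of_nonneg_left (hdev p).2
            (Finset.prod_nonneg fun i _ => abs_nonneg _)
      _ = -(3 / 2) * ∑ s : {s : Finset (Fin (2 * n)) // s.card = 4},
            ∑ p ∈ Fintype.piFinset (fun _ : Fin (2 * n) => Λ),
              (∏ i, |g (p i)|) * (nPoint μ spinAt (removeFour p s) * U (restrictFour p s)) := by
          rw [Finset.sum_comm, Finset.mul_sum]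
          refine Finset.sum_congr rfl fun p _ => ?_
          rw [Finset.mul_sum, Finset.mul_sum, Finset.mul_sum]
          refine Finset.sum_congr rfl fun s _ => ?_
          ring
      _ = -(3 / 2) * ∑ _s : {s : Finset (Fin (2 * n)) // s.card = 4}, A * B := by
          congr 1
          refine Finset.sum_congr rfl fun s _ => ?_
          rw [sum_prod_mul_removeFour_mul_restrictFour Λ (fun a => |g a|) (nPoint μ spinAt) U s]
      _ = -(3 / 2) * ((Fintype.card {s : Finset (Fin (2 * n)) // s.card = 4} : ℝ) * (A * B)) := by
          rw [Finset.sum_const, Finset.card_univ, nsmul_eq_mul]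
  -- Step 3: the case `Σ_L = 0` (then `c = 0` and both sides vanish / are non-negative)
  rcases hSig0.eq_or_lt with hSig | hSig
  · have hc' : c = 0 := by rw [hc, ← hSig, Real.sqrt_zero, inv_zero]
    rw [hc', zero_pow (by omega), zero_mul, abs_zero]
    exact hRHS0
  -- Step 4: `Σ_L > 0`: normalise by `c^{2n} = c^{2n-4} c⁴`, `c⁴ = Σ_L⁻²`
  have hcpos : 0 < c := inv_pos.mpr (Real.sqrt_pos.mpr hSig)
  have hc4 : c ^ 4 = (blockSpinVariance μ L ^ 2)⁻¹ := by
    rw [hc, inv_pow, show (4 : ℕ) = 2 * 2 from rfl, pow_mul, Real.sq_sqrt hSig0]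
  have hA0 : 0 ≤ A := by
    have h := hmomY0
    rw [hmomY] at h
    exact (mul_nonneg_iff_of_pos_left (pow_pos hcpos _)).mp h
  have hcard := (card_fourSubsets_le (n := n))
  have hcsplit : c ^ (2 * n) = c ^ (2 * n - 4) * c ^ 4 := by
    rw [← pow_add]; congr 1; omega
  rw [abs_mul, abs_of_nonneg (pow_nonneg hc0 _), hcsplit]
  calc c ^ (2 * n - 4) * c ^ 4 * |∑ p ∈ Fintype.piFinset (fun _ : Fin (2 * n) => Λ),
        (∏ i, g (p i)) * (nPoint μ spinAt p - G p)|
      ≤ c ^ (2 * n - 4) * c ^ 4 *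
          (-(3 / 2) * ((Fintype.card {s : Finset (Fin (2 * n)) // s.card = 4} : ℝ) * (A * B))) :=
        mul_le_mul_of_nonneg_left hsum (by positivity)
    _ = 3 / 2 * (Fintype.card {s : Finset (Fin (2 * n)) // s.card = 4} : ℝ) *
          (c ^ (2 * n - 4) * A) * (c ^ 4 * -B) := by ring
    _ ≤ 3 / 2 * (Fintype.card {s : Finset (Fin (2 * n)) // s.card = 4} : ℝ) *
          (c ^ (2 * n - 4) * A) * (c ^ 4 * (M ^ 4 * Us)) :=
        mul_le_mul_of_nonneg_left (mul_le_mul_of_nonneg_left hB (pow_nonneg hc0 4))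
          (mul_nonneg (mul_nonneg (by norm_num) (Nat.cast_nonneg _))
            (mul_nonneg (pow_nonneg hc0 _) hA0))
    _ ≤ 3 / 2 * (2 * n : ℝ) ^ 4 * (c ^ (2 * n - 4) * A) * (c ^ 4 * (M ^ 4 * Us)) :=
        mul_le_mul_of_nonneg_right (mul_le_mul_of_nonneg_right
          (mul_le_mul_of_nonneg_left hcard (by norm_num)) (mul_nonneg (pow_nonneg hc0 _) hA0))
          (mul_nonneg (pow_nonneg hc0 4) (mul_nonneg (pow_nonneg hM0 4)
            (Finset.sum_nonneg fun u _ => abs_nonneg _)))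
    _ = 3 / 2 * (2 * n : ℝ) ^ 4 *
          (∫ σ, normalizedField μ L (fun x => |f x|) σ ^ (2 * n - 4) ∂μ) * M ^ 4 *
            ursellFourSum μ L r := by
        rw [hmomY, hS, hc4, div_eq_mul_inv]
        ring

/-- **Vacuous since 2026-08-15** (the hypothesis `aizenman_pairingSum_sub_nPoint_le` is refuted,
`not_aizenman_pairingSum_sub_nPoint_le`; so is the conclusion, `not_aizenman_evenMoment_deviation_le`,
both in `AizenmanWickBoundRefutations`; the corrected smeared bound is
`abs_integral_normalizedField_pow_sub_le_of_wickBounds` of `AizenmanWickBound`). The record: the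
two pointwise named facts `aizenman_nPoint_le_pairingSum` and `aizenman_pairingSum_sub_nPoint_le`
imply the smeared bound `aizenman_evenMoment_deviation_le` of `HighDimTrivialityMoments`, as in
ADC 2021, §6.3, from (6.44) to (6.45). [cite: AizenmanDuminilCopinAnnals2021, arXiv:1912.07973 §6.3, first two displays (p. 26)] -/
@[deprecated "vacuous since 2026-08-15: its hypothesis Literature.Probability.LatticeModels.aizenman_pairingSum_sub_nPoint_le is refuted (not_aizenman_pairingSum_sub_nPoint_le, AizenmanWickBoundRefutations.lean) and so is its conclusion (not_aizenman_evenMoment_deviation_le); use Literature.Probability.LatticeModels.abs_integral_normalizedField_pow_sub_le_of_wickBounds (AizenmanWickBound.lean)" (since := "2026-08-15")]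
theorem aizenman_evenMoment_deviation_le_of_pointwise (hlow : aizenman_nPoint_le_pairingSum)
    (hup : aizenman_pairingSum_sub_nPoint_le) : aizenman_evenMoment_deviation_le := by
  intro d hd β L r hβ hβc hL hr μ hμ f hf hfr n hn
  haveI : IsProbabilityMeasure μ := hμ.1
  exact abs_integral_normalizedField_pow_sub_le_of_pairingBounds (hlow hd β hβ hβc μ hμ)
    (hup hd β hβ hβc μ hμ) hL hf hfr hn

/-! ### Part L. crit-ising.S13 (printed regime) from Aizenman's inequality and the structural facts -/

universe u in
/-- **Vacuous since 2026-08-15** (the hypothesis `aizenman_pairingSum_sub_nPoint_le` is refuted,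
`not_aizenman_pairingSum_sub_nPoint_le`; superseded by
`isGaussianProcess_of_tendstoInDistribution_smearedSpin_printRegime_of_wickDeviation` of
`HighDimTrivialityProofs`, whose random-current input is the source form
`aizenman_wickDeviation_le_finite`). The record: **crit-ising.S13 in the printed regime, with the
random-current input at the level of correlation functions.** The Gaussianity of scaling limits
`isGaussianProcess_of_tendstoInDistribution_smearedSpin_printRegime` follows from
(i) Aizenman's two-sided inequality for the `2n`-point function (the first display of ADC §6.3:
`aizenman_nPoint_le_pairingSum`, `aizenman_pairingSum_sub_nPoint_le`), (ii) the two bounds on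
`∑ |U₄|` (`aizenmanDuminilCopin_ursellFourSum_le`, `d = 4`; `panis_ursellFourSum_le`, `d ≥ 5`),
and (iii) the structure of `𝒢(β, 0)` up to `β_c` (uniqueness below and at `β_c`, the free
state, finite-volume flip symmetry), via `…_printRegime_of_facts` of `HighDimTrivialityMoments`. [cite: AizenmanDuminilCopinAnnals2021, arXiv:1912.07973 Prop. 1.4 and §6.3 (p. 26)] [cite: Panis2023Triviality, Thm. 5.5] -/
@[deprecated "vacuous since 2026-08-15: its hypothesis Literature.Probability.LatticeModels.aizenman_pairingSum_sub_nPoint_le is refuted (not_aizenman_pairingSum_sub_nPoint_le, AizenmanWickBoundRefutations.lean); use Literature.Probability.LatticeModels.isGaussianProcess_of_tendstoInDistribution_smearedSpin_printRegime_of_wickDeviation (HighDimTrivialityProofs.lean)" (since := "2026-08-15")]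
theorem isGaussianProcess_of_tendstoInDistribution_smearedSpin_printRegime_of_pointwise
    (hlow : aizenman_nPoint_le_pairingSum) (hup : aizenman_pairingSum_sub_nPoint_le)
    (hS₄ : aizenmanDuminilCopin_ursellFourSum_le) (hS₅ : panis_ursellFourSum_le)
    (hU₁ : ∀ {d : ℕ} {β : ℝ}, hasUniqueGibbsMeasure_of_lt_criticalBeta (d := d) (β := β))
    (hU₂ : ∀ {d : ℕ}, hasUniqueGibbsMeasure_criticalBeta (d := d))
    (hF : ∀ (d : ℕ) {β : ℝ}, exists_freeMeasure d (β := β) 0)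
    (hodd : ∀ d : ℕ, isingCorr_free_of_odd_card (zdGraph d)) :
    isGaussianProcess_of_tendstoInDistribution_smearedSpin_printRegime.{u} :=
  isGaussianProcess_of_tendstoInDistribution_smearedSpin_printRegime_of_facts
    (aizenman_evenMoment_deviation_le_of_pointwise hlow hup)
    (newman_evenMoment_le_of_pointwise hlow) hS₄ hS₅ hU₁ hU₂ hF hodd

/-! ### Part M. From finite volume to the infinite-volume state -/

/-- **Spin monomials are set correlations** (no parity assumption): for sites `y₁, …, y_m`
(repetitions allowed), `∏ᵢ σ_{yᵢ} = σ_A` with `A ⊆ {y₁,…,y_m}` the set of sites occurring an odd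
number of times (`σ_y² = 1`; Friedli–Velenik 2017, §3.6.1, notation `σ_A`). [cite: FriedliVelenik2017, §3.6.1] -/
theorem exists_prod_spinAt_eq_spinProduct_subset {V : Type*} [DecidableEq V] {m : ℕ}
    (y : Fin m → V) :
    ∃ A : Finset V, A ⊆ Finset.univ.image y ∧
      ∀ σ : SpinConfig V, ∏ i, spinAt (y i) σ = spinProduct A σ := by
  classical
  refine ⟨(Finset.univ.image y).filter fun b =>
      Odd ((Finset.univ.filter fun i : Fin m => y i = b).card),
    Finset.filter_subset _ _, fun σ => ?_⟩
  rw [spinProduct, Finset.prod_filter,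
    Finset.prod_comp (s := (Finset.univ : Finset (Fin m))) (fun b => spinAt b σ) y]
  exact Finset.prod_congr rfl fun b _ => spinAt_pow_eq_ite b σ _

/-- **Thermodynamic limit of the correlation functions of the free state.** If the correlations
of `μ` are the free box limits `⟨σ_A⟩^∅_{β,0}` (`spinCorr μ A = freeCorr d β 0 A` for all `A`),
then `⟨σ_{y₁} ⋯ σ_{y_m}⟩^∅_{Λ_L;β,0} → ⟨σ_{y₁} ⋯ σ_{y_m}⟩_μ` as `L → ∞`
(Friedli–Velenik 2017, Exercise 3.16 / Thm. 3.17: existence of the free box limits, the tree's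
`hasBoxLimit_isingCorr_free_holds`). [cite: FriedliVelenik2017, Exercise 3.16] -/
theorem tendsto_nPoint_box_free {β : ℝ} (hβ : 0 ≤ β) {μ : Measure (SpinConfig (Site d))}
    (hcorr : ∀ A : Finset (Site d), spinCorr μ A = freeCorr d β 0 A) {m : ℕ}
    (y : Fin m → Site d) :
    Tendsto (fun L : ℕ => nPoint (isingMeasure (zdGraph d) (box d L) β 0 .free) spinAt y)
      atTop (𝓝 (nPoint μ spinAt y)) := by
  classical
  obtain ⟨A, -, hA⟩ := exists_prod_spinAt_eq_spinProduct_subset y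
  have h1 : ∀ ν : Measure (SpinConfig (Site d)), nPoint ν spinAt y = ∫ σ, spinProduct A σ ∂ν :=
    fun ν => by simp only [nPoint, hA]
  simp_rw [h1]
  rw [show (∫ σ, spinProduct A σ ∂μ) = freeCorr d β 0 A from hcorr A]
  exact hasBoxLimit_isingCorr_free_holds (d := d) hβ le_rfl A

/-- The two-point functions of the free boxes converge to those of the free state. [cite: FriedliVelenik2017, Exercise 3.16] -/
theorem tendsto_twoPoint_box_free {β : ℝ} (hβ : 0 ≤ β) {μ : Measure (SpinConfig (Site d))}
    (hcorr : ∀ A : Finset (Site d), spinCorr μ A = freeCorr d β 0 A) (a b : Site d) :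
    Tendsto (fun L : ℕ => twoPoint (isingMeasure (zdGraph d) (box d L) β 0 .free) spinAt a b)
      atTop (𝓝 (twoPoint μ spinAt a b)) := by
  simp_rw [twoPoint_eq_nPoint]
  exact tendsto_nPoint_box_free hβ hcorr ![a, b]

/-- `𝒢_n[S₂]` is continuous in the two-point function (a polynomial in finitely many values). [folklore] -/
theorem tendsto_pairingSum {α ι : Type*} {l : Filter ι} {S : ι → α → α → ℝ} {S₀ : α → α → ℝ}
    (h : ∀ a b, Tendsto (fun i => S i a b) l (𝓝 (S₀ a b))) (n : ℕ) (x : Fin (2 * n) → α) :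
    Tendsto (fun i => pairingSum (S i) n x) l (𝓝 (pairingSum S₀ n x)) := by
  unfold pairingSum
  exact Tendsto.const_mul _ (tendsto_finsetSum _ fun τ _ => tendsto_finsetProd _ fun j _ => h _ _)

/-- `U₄` of the free boxes converges to `U₄` of the free state. [cite: FriedliVelenik2017, Exercise 3.16] -/
theorem tendsto_connectedFour_box_free {β : ℝ} (hβ : 0 ≤ β) {μ : Measure (SpinConfig (Site d))}
    (hcorr : ∀ A : Finset (Site d), spinCorr μ A = freeCorr d β 0 A) (u : Fin 4 → Site d) :
    Tendsto (fun L : ℕ => connectedFour (isingMeasure (zdGraph d) (box d L) β 0 .free) spinAt u)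
      atTop (𝓝 (connectedFour μ spinAt u)) := by
  unfold connectedFour
  have hN := tendsto_nPoint_box_free hβ hcorr u
  have hT := fun a b => tendsto_twoPoint_box_free hβ hcorr a b
  exact ((hN.sub ((hT _ _).mul (hT _ _))).sub ((hT _ _).mul (hT _ _))).sub ((hT _ _).mul (hT _ _))

/-- All the points `y₁,…,y_m` lie in the box `Λ_L` for `L` large. [folklore] -/
theorem eventually_forall_mem_box {m : ℕ} (y : Fin m → Site d) :
    ∀ᶠ L : ℕ in atTop, ∀ i, y i ∈ box d L := by
  classical
  obtain ⟨L₀, hL₀⟩ := exists_forall_subset_box d (Finset.univ.image y)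
  filter_upwards [eventually_ge_atTop L₀] with L hL i
  exact hL₀ L hL (Finset.mem_image_of_mem y (Finset.mem_univ i))

/-- **Passage to the limit, lower half.** The finite-volume lower inequality
(`aizenman_nPoint_le_pairingSum_finite`) passes to every state whose correlations are the free
box limits (Aizenman–Duminil-Copin 2021, §6.3, first display, stated for the infinite-volume
state `S_β`). [cite: AizenmanDuminilCopinAnnals2021, arXiv:1912.07973 §6.3, first display (p. 26)] -/
theorem pairingLowerBound_of_finite (hfin : aizenman_nPoint_le_pairingSum_finite) {β : ℝ}
    (hβ : 0 ≤ β) {μ : Measure (SpinConfig (Site d))}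
    (hcorr : ∀ A : Finset (Site d), spinCorr μ A = freeCorr d β 0 A) : PairingLowerBound μ := by
  intro n hn x
  refine le_of_tendsto_of_tendsto (tendsto_nPoint_box_free hβ hcorr x)
    (tendsto_pairingSum (fun a b => tendsto_twoPoint_box_free hβ hcorr a b) n x) ?_
  filter_upwards [eventually_forall_mem_box x] with L hL
  exact hfin (box d L) β hβ n hn x hL

/-- **Vacuous since 2026-08-15** (the hypothesis `aizenman_pairingSum_sub_nPoint_le_finite` is
refuted, `not_aizenman_pairingSum_sub_nPoint_le_finite`, and so is the conclusion for a
probability measure, `not_pairingUpperBound`; the source-form passage to the limit is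
`wickDeviationBound_of_finite` of `AizenmanWickBound`). The record: **passage to the limit, upper
half** — the finite-volume upper inequality (`aizenman_pairingSum_sub_nPoint_le_finite`) passes
to every state whose correlations are the free box limits. [cite: AizenmanDuminilCopinAnnals2021, arXiv:1912.07973 §6.3, first display (p. 26)] -/
@[deprecated "vacuous since 2026-08-15: its hypothesis Literature.Probability.LatticeModels.aizenman_pairingSum_sub_nPoint_le_finite is refuted (not_aizenman_pairingSum_sub_nPoint_le_finite, AizenmanWickBoundLocal.lean) and no probability measure satisfies PairingUpperBound (not_pairingUpperBound); use Literature.Probability.LatticeModels.wickDeviationBound_of_finite (AizenmanWickBound.lean)" (since := "2026-08-15")]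
theorem pairingUpperBound_of_finite (hfin : aizenman_pairingSum_sub_nPoint_le_finite) {β : ℝ}
    (hβ : 0 ≤ β) {μ : Measure (SpinConfig (Site d))}
    (hcorr : ∀ A : Finset (Site d), spinCorr μ A = freeCorr d β 0 A) : PairingUpperBound μ := by
  intro n hn x
  have hT := fun a b => tendsto_twoPoint_box_free hβ hcorr a b
  refine le_of_tendsto_of_tendsto
    ((tendsto_pairingSum hT n x).sub (tendsto_nPoint_box_free hβ hcorr x))
    (Tendsto.const_mul _ (tendsto_finsetSum _ fun s _ =>
      (tendsto_nPoint_box_free hβ hcorr _).mul (tendsto_connectedFour_box_free hβ hcorr _))) ?_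
  filter_upwards [eventually_forall_mem_box x] with L hL
  exact hfin (box d L) β hβ n hn x hL

/-- **Vacuous since 2026-08-15** (the hypothesis `aizenman_pairingSum_sub_nPoint_le_finite` is
refuted, `not_aizenman_pairingSum_sub_nPoint_le_finite`; superseded by
`pairingLowerBound_and_wickDeviationBound_of_freeCorr` of `AizenmanWickBound`). The record:
**Aizenman's inequality for the states `μ ∈ 𝒢(β,0)`, `β ≤ β_c`, `d ≥ 3`, from finite
volume.** Uniqueness of the Gibbs measure (`hasUniqueGibbsMeasure_of_lt_criticalBeta`,
`hasUniqueGibbsMeasure_criticalBeta`) and the free state (`exists_freeMeasure`) identify `μ`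
with the free state, to which the finite-volume inequalities pass in the limit. (The case
`d = 2`, `β = β_c(2)` of the printed infinite-volume statement would in addition need uniqueness
at criticality in two dimensions, which the tree records through the Onsager–Yang route; it is
not needed below.) [cite: AizenmanDuminilCopinAnnals2021, arXiv:1912.07973 §6.3, first display (p. 26)] [cite: FriedliVelenik2017, Thm. 3.28 and Exercise 3.16] -/
@[deprecated "vacuous since 2026-08-15: its hypothesis Literature.Probability.LatticeModels.aizenman_pairingSum_sub_nPoint_le_finite is refuted (not_aizenman_pairingSum_sub_nPoint_le_finite, AizenmanWickBoundLocal.lean); use Literature.Probability.LatticeModels.pairingLowerBound_and_wickDeviationBound_of_freeCorr (AizenmanWickBound.lean)" (since := "2026-08-15")]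
theorem pairingBounds_of_finite_of_facts (hfinL : aizenman_nPoint_le_pairingSum_finite)
    (hfinU : aizenman_pairingSum_sub_nPoint_le_finite)
    (hU₁ : ∀ {d : ℕ} {β : ℝ}, hasUniqueGibbsMeasure_of_lt_criticalBeta (d := d) (β := β))
    (hU₂ : ∀ {d : ℕ}, hasUniqueGibbsMeasure_criticalBeta (d := d))
    (hF : ∀ (d : ℕ) {β : ℝ}, exists_freeMeasure d (β := β) 0)
    (hd : 3 ≤ d) {β : ℝ} (hβ : 0 ≤ β) (hβc : β ≤ criticalBeta d)
    {μ : Measure (SpinConfig (Site d))} (hμ : μ ∈ isingGibbsMeasures d β 0) :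
    PairingLowerBound μ ∧ PairingUpperBound μ := by
  classical
  obtain ⟨μf, hμf, -, hcorr⟩ := hF d hβ le_rfl
  have huniq : HasUniqueGibbsMeasure (isingSpecification (zdGraph d) β 0) := by
    rcases hβc.lt_or_eq with hlt | heq
    · exact hU₁ (by omega) hβ hlt
    · rw [heq]
      exact hU₂ hd
  have hμeq : μ = μf := huniq.1 hμ hμf
  subst hμeq
  exact ⟨pairingLowerBound_of_finite hfinL hβ hcorr, pairingUpperBound_of_finite hfinU hβ hcorr⟩

/-! ### Part N. crit-ising.S13 (printed regime) from the finite-volume inequality -/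

/-- **One state, one test function, from the two halves of the quoted inequality for that
state** (vacuous since 2026-08-15: no probability measure satisfies `PairingUpperBound`,
`not_pairingUpperBound`; the source-form version is
`abs_mgf_normalizedField_sub_exp_le_of_wickBounds` of `AizenmanWickBound`; the local form of
`abs_mgf_normalizedField_sub_exp_le` of `HighDimTrivialityMoments`):
for `d ≥ 3`, `0 ≤ β ≤ β_c`, `μ ∈ 𝒢(β,0)` satisfying `PairingLowerBound μ` and
`PairingUpperBound μ`, `L > 0` and `f ∈ C_0` vanishing outside `[-r,r]^d`,
`|⟨exp(z T_{f,L})⟩ - exp(z²/2 ⟨T_{f,L}²⟩)| ≤ exp(z²/2 ⟨T_{|f|,L}²⟩) · 24 ‖f‖_∞⁴ S(μ; L, r) z⁴`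
(Aizenman–Duminil-Copin 2021, §6.3, p. 26). [cite: AizenmanDuminilCopinAnnals2021, arXiv:1912.07973 §6.3 (p. 26)] -/
theorem abs_mgf_normalizedField_sub_exp_le_of_pairingBounds
    (hodd : oddSpinCorrelation_eq_zero) (hd : 3 ≤ d) {β L r : ℝ} (hβ : 0 ≤ β)
    (hβc : β ≤ criticalBeta d) (hL : 0 < L)
    {μ : Measure (SpinConfig (Site d))} (hμ : μ ∈ isingGibbsMeasures d β 0)
    (hlow : PairingLowerBound μ) (hup : PairingUpperBound μ)
    {f : EuclideanSpace ℝ (Fin d) → ℝ} (hf : Continuous f)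
    (hfr : ∀ x, f x ≠ 0 → ∀ i, |x i| ≤ r) (z : ℝ) :
    |(∫ σ, Real.exp (z * normalizedField μ L f σ) ∂μ) -
        Real.exp (z ^ 2 / 2 * ∫ σ, normalizedField μ L f σ ^ 2 ∂μ)|
      ≤ Real.exp (z ^ 2 / 2 * ∫ σ, normalizedField μ L (fun x => |f x|) σ ^ 2 ∂μ) *
          (24 * (⨆ x, |f x|) ^ 4 * ursellFourSum μ L r * z ^ 4) := by
  haveI : IsProbabilityMeasure μ := hμ.1
  have hLne : L ≠ 0 := hL.ne'
  have hfar : ∀ x, (fun y => |f y|) x ≠ 0 → ∀ i, |x i| ≤ r := fun x hx =>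
    hfr x (abs_ne_zero.mp hx)
  set E : ℝ := 3 / 2 * (⨆ x, |f x|) ^ 4 * ursellFourSum μ L r with hE_def
  have hE : 0 ≤ E :=
    mul_nonneg (mul_nonneg (by norm_num) (pow_nonneg (iSup_abs_nonneg f) 4))
      (ursellFourSum_nonneg μ L r)
  have key := abs_mgf_sub_exp_le_of_moment_bounds (μ := μ) (X := normalizedField μ L f)
    (Y := normalizedField μ L fun x => |f x|) (measurable_normalizedField μ hLne hfr)
    (abs_normalizedField_le μ hLne hfr) hE ?_ ?_ ?_ z
  · calc _ ≤ 16 * E * z ^ 4 *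
          Real.exp (z ^ 2 / 2 * ∫ σ, normalizedField μ L (fun x => |f x|) σ ^ 2 ∂μ) := key
      _ = _ := by rw [hE_def]; ring
  · intro n hn
    calc _ ≤ _ := abs_integral_normalizedField_pow_sub_le_of_pairingBounds hlow hup hL hf hfr hn
      _ = _ := by rw [hE_def]; ring
  · intro n
    exact integral_normalizedField_pow_le_of_pairingLowerBound hlow hL
      (hasCompactSupport_of_cube hfar) (fun x => abs_nonneg _) n
  · intro n
    exact integral_normalizedField_pow_eq_zero_of_odd hodd hd hβ hβc hμ hLne hfr ⟨n, rfl⟩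

/-- **Vacuous since 2026-08-15** (the hypothesis `aizenman_pairingSum_sub_nPoint_le_finite` is
refuted, `not_aizenman_pairingSum_sub_nPoint_le_finite`; superseded by
`aizenmanDuminilCopin_mgf_normalizedField_bound_abs_of_wickDeviation` of `AizenmanWickBound`,
from the source form `aizenman_wickDeviation_le_finite`). The record: **ADC Prop. 1.4 (in the
form its proof yields) from the finite-volume inequality**: the two
finite-volume halves of the quoted inequality, the `d = 4` bound on `∑ |U₄|` in the critical
window and the structural facts on `𝒢(β,0)` (uniqueness, free state, finite-volume flip
symmetry) imply `aizenmanDuminilCopin_mgf_normalizedField_bound_abs`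
(Aizenman–Duminil-Copin 2021, §6.3, proof of Prop. 1.4, p. 26). [cite: AizenmanDuminilCopinAnnals2021, arXiv:1912.07973 §6.3, proof of Prop. 1.4 (p. 26)] -/
@[deprecated "vacuous since 2026-08-15: its hypothesis Literature.Probability.LatticeModels.aizenman_pairingSum_sub_nPoint_le_finite is refuted (not_aizenman_pairingSum_sub_nPoint_le_finite, AizenmanWickBoundLocal.lean); use Literature.Probability.LatticeModels.aizenmanDuminilCopin_mgf_normalizedField_bound_abs_of_wickDeviation (AizenmanWickBound.lean)" (since := "2026-08-15")]
theorem aizenmanDuminilCopin_mgf_normalizedField_bound_abs_of_finite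
    (hfinL : aizenman_nPoint_le_pairingSum_finite)
    (hfinU : aizenman_pairingSum_sub_nPoint_le_finite)
    (hS : aizenmanDuminilCopin_ursellFourSum_le)
    (hU₁ : ∀ {d : ℕ} {β : ℝ}, hasUniqueGibbsMeasure_of_lt_criticalBeta (d := d) (β := β))
    (hU₂ : ∀ {d : ℕ}, hasUniqueGibbsMeasure_criticalBeta (d := d))
    (hF : ∀ (d : ℕ) {β : ℝ}, exists_freeMeasure d (β := β) 0)
    (hodd : ∀ d : ℕ, isingCorr_free_of_odd_card (zdGraph d)) :
    aizenmanDuminilCopin_mgf_normalizedField_bound_abs := by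
  have hodd' : oddSpinCorrelation_eq_zero := oddSpinCorrelation_eq_zero_of_facts hU₁ hU₂ hF hodd
  obtain ⟨c, C, hc, hC, H⟩ := hS
  refine ⟨c, 24 * C, hc, by positivity, fun β L r hβ hβc hreg hL hr μ hμ f hf hfr z => ?_⟩
  have hSle := H β L r hβ hβc hreg hL hr μ hμ
  obtain ⟨hlow, hup⟩ := pairingBounds_of_finite_of_facts hfinL hfinU hU₁ hU₂ hF (by norm_num)
    hβ hβc hμ
  have key := abs_mgf_normalizedField_sub_exp_le_of_pairingBounds hodd' (by norm_num) hβ hβc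
    (one_pos.trans hL) hμ hlow hup hf hfr z
  refine key.trans (mul_le_mul_of_nonneg_left ?_ (Real.exp_pos _).le)
  have h0 : 0 ≤ (⨆ x, |f x|) ^ 4 := pow_nonneg (iSup_abs_nonneg f) 4
  have hz : 0 ≤ z ^ 4 := by positivity
  calc 24 * (⨆ x, |f x|) ^ 4 * ursellFourSum μ L r * z ^ 4
      ≤ 24 * (⨆ x, |f x|) ^ 4 * (C * r ^ 12 / Real.log L ^ c) * z ^ 4 := by gcongr
    _ = 24 * C * (⨆ x, |f x|) ^ 4 * r ^ 12 * z ^ 4 / Real.log L ^ c := by ring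

/-- **Vacuous since 2026-08-15** (the hypothesis `aizenman_pairingSum_sub_nPoint_le_finite` is
refuted, `not_aizenman_pairingSum_sub_nPoint_le_finite`; superseded by
`panis_mgf_normalizedField_bound_of_wickDeviation` of `HighDimTrivialityProofs`, from the source
form `aizenman_wickDeviation_le_finite`). The record: **Panis Thm 5.5 (`d ≥ 5`,
nearest-neighbour) from the finite-volume inequality**: the two
finite-volume halves of the quoted inequality, the `d ≥ 5` bound on `∑ |U₄|`
(`panis_ursellFourSum_le`) and the structural facts on `𝒢(β,0)` imply
`panis_mgf_normalizedField_bound` (Panis 2023, proof of Thm 5.5, pp. 21–22). [cite: Panis2023Triviality, proof of Thm. 5.5 (pp. 21–22)] -/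
@[deprecated "vacuous since 2026-08-15: its hypothesis Literature.Probability.LatticeModels.aizenman_pairingSum_sub_nPoint_le_finite is refuted (not_aizenman_pairingSum_sub_nPoint_le_finite, AizenmanWickBoundLocal.lean); use Literature.Probability.LatticeModels.panis_mgf_normalizedField_bound_of_wickDeviation (HighDimTrivialityProofs.lean)" (since := "2026-08-15")]
theorem panis_mgf_normalizedField_bound_of_finite
    (hfinL : aizenman_nPoint_le_pairingSum_finite)
    (hfinU : aizenman_pairingSum_sub_nPoint_le_finite)
    (hS : panis_ursellFourSum_le)
    (hU₁ : ∀ {d : ℕ} {β : ℝ}, hasUniqueGibbsMeasure_of_lt_criticalBeta (d := d) (β := β))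
    (hU₂ : ∀ {d : ℕ}, hasUniqueGibbsMeasure_criticalBeta (d := d))
    (hF : ∀ (d : ℕ) {β : ℝ}, exists_freeMeasure d (β := β) 0)
    (hodd : ∀ d : ℕ, isingCorr_free_of_odd_card (zdGraph d)) :
    panis_mgf_normalizedField_bound := by
  have hodd' : oddSpinCorrelation_eq_zero := oddSpinCorrelation_eq_zero_of_facts hU₁ hU₂ hF hodd
  intro d hd
  obtain ⟨C, γ, hC, hγ, H⟩ := hS hd
  refine ⟨24 * C, γ, by positivity, hγ, fun β L r hβ hβc hL hr μ hμ f hf hfr z => ?_⟩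
  have hSle := H β L r hβ hβc hL hr μ hμ
  obtain ⟨hlow, hup⟩ := pairingBounds_of_finite_of_facts hfinL hfinU hU₁ hU₂ hF (by omega)
    hβ.le hβc hμ
  have key := abs_mgf_normalizedField_sub_exp_le_of_pairingBounds hodd' (by omega) hβ.le hβc
    (one_pos.trans_le hL) hμ hlow hup hf hfr z
  refine key.trans (mul_le_mul_of_nonneg_left ?_ (Real.exp_pos _).le)
  have h0 : 0 ≤ (⨆ x, |f x|) ^ 4 := pow_nonneg (iSup_abs_nonneg f) 4
  have hz : 0 ≤ z ^ 4 := by positivity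
  calc 24 * (⨆ x, |f x|) ^ 4 * ursellFourSum μ L r * z ^ 4
      ≤ 24 * (⨆ x, |f x|) ^ 4 *
          (C * max (β ^ (-4 : ℤ)) (β ^ (-2 : ℤ)) * r ^ γ / L ^ (d - 4)) * z ^ 4 := by gcongr
    _ = 24 * C * max (β ^ (-4 : ℤ)) (β ^ (-2 : ℤ)) * (⨆ x, |f x|) ^ 4 * r ^ γ * z ^ 4 /
          L ^ (d - 4) := by ring

universe u in
/-- **Vacuous since 2026-08-15** (the hypothesis `aizenman_pairingSum_sub_nPoint_le_finite` is
refuted, `not_aizenman_pairingSum_sub_nPoint_le_finite`; superseded by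
`isGaussianProcess_of_tendstoInDistribution_smearedSpin_printRegime_of_wickDeviation` of
`HighDimTrivialityProofs`, whose random-current input is the source form
`aizenman_wickDeviation_le_finite`). The record: **crit-ising.S13 in the printed regime from the
finite-volume form of the quoted inequality.** The Gaussianity of scaling limits
`isGaussianProcess_of_tendstoInDistribution_smearedSpin_printRegime` follows from
(i) the two halves of Aizenman's inequality **in finite volume** (free boundary condition:
`aizenman_nPoint_le_pairingSum_finite`, `aizenman_pairingSum_sub_nPoint_le_finite` — the form
the switching lemma yields), (ii) the two bounds on `∑ |U₄|`
(`aizenmanDuminilCopin_ursellFourSum_le`, `d = 4`, ADC Thm 1.3 + §6.3; `panis_ursellFourSum_le`,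
`d ≥ 5`, Panis §5), and (iii) the structure of `𝒢(β, 0)` up to `β_c`: uniqueness
(`hasUniqueGibbsMeasure_of_lt_criticalBeta`, `hasUniqueGibbsMeasure_criticalBeta`), the free
state (`exists_freeMeasure`) and the finite-volume flip symmetry (`isingCorr_free_of_odd_card`),
through the thermodynamic limit (Part M), the smearing (Part K), the summation
(`HighDimTrivialityMoments`, Part C) and the assembly (`…_of_bounds'`). [cite: AizenmanDuminilCopinAnnals2021, arXiv:1912.07973 Prop. 1.4, Thm 1.3 and §6.3 (p. 26)] [cite: Panis2023Triviality, Thm. 5.5] -/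
@[deprecated "vacuous since 2026-08-15: its hypothesis Literature.Probability.LatticeModels.aizenman_pairingSum_sub_nPoint_le_finite is refuted (not_aizenman_pairingSum_sub_nPoint_le_finite, AizenmanWickBoundLocal.lean); use Literature.Probability.LatticeModels.isGaussianProcess_of_tendstoInDistribution_smearedSpin_printRegime_of_wickDeviation (HighDimTrivialityProofs.lean)" (since := "2026-08-15")]
theorem isGaussianProcess_of_tendstoInDistribution_smearedSpin_printRegime_of_finite
    (hfinL : aizenman_nPoint_le_pairingSum_finite)
    (hfinU : aizenman_pairingSum_sub_nPoint_le_finite)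
    (hS₄ : aizenmanDuminilCopin_ursellFourSum_le) (hS₅ : panis_ursellFourSum_le)
    (hU₁ : ∀ {d : ℕ} {β : ℝ}, hasUniqueGibbsMeasure_of_lt_criticalBeta (d := d) (β := β))
    (hU₂ : ∀ {d : ℕ}, hasUniqueGibbsMeasure_criticalBeta (d := d))
    (hF : ∀ (d : ℕ) {β : ℝ}, exists_freeMeasure d (β := β) 0)
    (hodd : ∀ d : ℕ, isingCorr_free_of_odd_card (zdGraph d)) :
    isGaussianProcess_of_tendstoInDistribution_smearedSpin_printRegime.{u} :=
  isGaussianProcess_of_tendstoInDistribution_smearedSpin_printRegime_of_bounds'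
    (aizenmanDuminilCopin_mgf_normalizedField_bound_abs_of_finite hfinL hfinU hS₄ hU₁ hU₂ hF hodd)
    (normalizedField_variance_bounds_of_facts hU₁ hU₂ hF)
    (panis_mgf_normalizedField_bound_of_finite hfinL hfinU hS₅ hU₁ hU₂ hF hodd)

end Literature.Probability.LatticeModels
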